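import Literature.AnabelianGeometry.EtaleTheta.SettingGaloisFacts

/-!
# [EtTh] §1: the level-`1` degenerations `J₁ = K₁`, `Z₁ = Y₁`, `Z̈₁ = Ÿ` of the theta setting

Mochizuki, *The étale theta function …* [EtTh], Publ. RIMS **45** (2009), §1, PRIMS PDF pp. 13–17
[cite: MochizukiEtTh2009, §1 p.17]. PROVED structural identities of the root interface `ThetaSetting`
(`Setting.lean`) at level `N = 1`: "`J_N := K_N(a^{1/N})_{a ∈ K_N}`" gives `J₁ = K₁` (p. 14), the exact
sequence `1 → Δ_Θ ⊗ ℤ/Nℤ → Gal(Z_N/Y_N) → Gal(J_N/K_N) → 1` (p. 14) gives `Z₁ = Y₁`, and with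
"`Ÿ := Ÿ₁`" (p. 17) the composite `Z̈₁` of `Ÿ₁` and `Z₁` over `Y₁` is `Ÿ` itself.

Use: the `N = 1` SANITY TEST for level-`N` named facts over `ThetaSetting` — any clause quantified over
all `N ≥ 1` must survive `Π^tp_{Z̈₁} ∩ Π^tp_Ÿ = Π^tp_Ÿ` (this is how the integral form of the `Z̈_N`-clause
of Prop. 1.3 was refuted in review, 2026-08-25). Seat abc-iut-L6-t23 (RQ7 audit). No named facts.
-/

noncomputable section

namespace Literature.AnabelianGeometry.EtaleTheta

namespace ThetaSetting

variable {p : ℕ} [Fact p.Prime]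

/-- `J₁ = K₁(a^{1/1} : a ∈ K₁) = K₁` ("`J_N := K_N(a^{1/N})_{a ∈ K_N}`", p. 14, at `N = 1`).
[cite: MochizukiEtTh2009, §1 p.14] -/
theorem fieldJN_one (K : IntermediateField ℚ_[p] (PadicAlgCl p)) (q : PadicAlgCl p) :
    fieldJN K q 1 = fieldKN K q 1 := by
  apply le_antisymm
  · rw [fieldJN, IntermediateField.adjoin_le_iff]
    rintro x (hx | hx)
    · exact hx
    · simpa using hx
  · intro x hx
    exact IntermediateField.subset_adjoin _ _ (Or.inl hx)

variable (D : ThetaSetting p)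

/-- **`Z₁ = Y₁`**: `Π^tp_{Z₁} = Π^tp_{Y₁}` — from `J₁ = K₁` (same image in `G_{ℚ_p}`) and
`[Δ^tp_{Y₁} : Δ^tp_{Z₁}] = 1` (the geometric Galois group of `Z_N → Y_N` is `Δ_Θ ⊗ ℤ/Nℤ`, p. 14).
[cite: MochizukiEtTh2009, §1 p.14] -/
theorem GtpZN_one : D.GtpZN 1 = D.GtpYN 1 := by
  apply le_antisymm (D.GtpZN_le 1)
  intro g hg
  have hmap : (D.GtpYN 1).map D.aug.toMonoidHom = (D.GtpZN 1).map D.aug.toMonoidHom := by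
    rw [D.map_aug_GtpYN, D.map_aug_GtpZN, fieldJN_one]
  have hgim : D.aug.toMonoidHom g ∈ (D.GtpZN 1).map D.aug.toMonoidHom := hmap ▸ ⟨g, hg, rfl⟩
  obtain ⟨h, hh, hhg⟩ := hgim
  have hrel := D.relIndex_deltaZN 1
  rw [PNat.one_coe, Subgroup.relIndex_eq_one] at hrel
  have hk : h⁻¹ * g ∈ D.GtpYN 1 ⊓ D.aug.toMonoidHom.ker := by
    refine Subgroup.mem_inf.mpr ⟨Subgroup.mul_mem _ (Subgroup.inv_mem _ (D.GtpZN_le 1 hh)) hg, ?_⟩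
    rw [MonoidHom.mem_ker, map_mul, map_inv, hhg, inv_mul_cancel]
  have hk' := hrel hk
  have : h * (h⁻¹ * g) ∈ D.GtpZN 1 := Subgroup.mul_mem _ hh (Subgroup.mem_inf.mp hk').1
  simpa using this

/-- `Π^tp_{Z₁} = Π^tp_Y` (`Y₁ = Y`, p. 14). [cite: MochizukiEtTh2009, §1 p.14] -/
theorem GtpZN_one_eq_GtpY : D.GtpZN 1 = D.GtpY := by
  rw [GtpZN_one, D.GtpYN_one]; rfl

/-- **`Ÿ ≤ Z̈₁`**: `Π^tp_Ÿ ≤ Π^tp_{Z̈₁}` ("`Z̈_N` for the composite of the coverings `Ÿ_N`, `Z_N` of `Y_N`",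
p. 17, with `Ÿ = Ÿ₁` and `Z₁ = Y₁`). [cite: MochizukiEtTh2009, §1 p.17] -/
theorem GtpYdd_le_GtpZddN_one : D.GtpYdd ≤ D.GtpZddN 1 := by
  intro g hg
  unfold GtpZddN
  refine Subgroup.mem_inf.mpr ⟨hg, ?_⟩
  rw [GtpZN_one]
  have h1 : g ∈ D.GtpYN (2 * 1) := by
    unfold GtpYdd GtpYddN at hg
    exact (Subgroup.mem_inf.mp hg).1
  exact D.GtpYN_anti 1 (2 * 1) (one_dvd _) h1

/-- **`Z̈₁ = Ÿ`**: `Π^tp_{Z̈₁} = Π^tp_Ÿ` (p. 17). [cite: MochizukiEtTh2009, §1 p.17] -/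
theorem GtpZddN_one : D.GtpZddN 1 = D.GtpYdd :=
  le_antisymm (fun _ hg => (Subgroup.mem_inf.mp hg).1) (GtpYdd_le_GtpZddN_one D)

/-- The level-`1` degeneration in the form level-`N` clauses meet it: `Π^tp_{Z̈₁} ∩ Π^tp_Ÿ = Π^tp_Ÿ`.
[cite: MochizukiEtTh2009, §1 p.17] -/
theorem GtpZddN_one_inf : D.GtpZddN 1 ⊓ D.GtpYdd = D.GtpYdd :=
  inf_eq_right.mpr (GtpYdd_le_GtpZddN_one D)

end ThetaSetting

end Literature.AnabelianGeometry.EtaleTheta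

end
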